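/-
Copyright (c) 2026 the pub-hodgecm-mathlib formalisation cell (harness21).  Prover seat hodgecm-mathlib-LH3-p02 (g6); dealer LH4-plan (g7) WORD #18 «(C6)-1»,
2026-09-02.  Count-neutral reader layer of the dyadic (D-UNR) column; CENSUS-C6-ReadersTrace 196c9bc3 §1 row 1 + §2 (FINDING #15).
-/
import Literature.NumberTheory.Rogawski1990.DepthZeroKappaTransferTypeOneUnitRowTrace   -- ★ p851796 (P3d): the setting, `exists_generalLinearGroup_diagPi`, (T2)(T3)(T5) re-exports
import Literature.NumberTheory.Automorphic.UnitaryConjClassClosed                   -- ★ `formCongr_mul`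
import Literature.NumberTheory.Automorphic.UnitaryGroupFormCongrFinSum               -- ★ `formCongr_one_eq`
import HarnessLib

/-!
# The depth-zero κ-transfer, type (1): ROW 2 — the TRACE frame of a trace literal read with its Gram matrix `diag(π, 1, −π)` (every residue characteristic)
# (Flicker 1998 §2 Prop. 3; Jacobowitz 1962 §4; Rogawski 1990 §4.9)

Topic `NumberTheory/Rogawski1990`; namespace `Literature.NumberTheory.Rogawski1990`.  THEOREMS ONLY (no definition, no instance, no notation, no named fact, no `sorry`);
kernel lane `--supports stmt-HodgeConjecture-24833`.  Cell `pub/hodgecm-mathlib`, crux H413; LH4 board (D-UNR), LAYER C readers: file (C6)-1 of CENSUS-C6-ReadersTrace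
(LH3-p02 (g6), sha16 196c9bc3b64f0cb5; LH4-plan (g7) WORD #18), the trace-frame twin of ★ `DepthZeroKappaTransferTypeOneRowTwoFrame` §3 (A-p19 (g25)).  Read with
CENSUS-R1 52a4c879 (LH4-p03), CENSUS-LAYERB-3of3 4277d501 and FINDING #6′; ROW 2's two `[C : R^×]` suppliers are the uniform twins (U1)(U2) (F0P3b-p01 ∕ F0P3a-p08), and
the COUNT heads `rankStrata_counts_of_congr_traceTorusElt{Pi,}` stay HYPOTHESES of ★ p851882 until (C6)-6 lands (census §0.4∕§3).

WHAT.  ★ `…RowTwoFrame` §3 reads a `t ∈ G′_v` congruent (`ψ g = Tl·g·Tl⁻¹`, `Tl` an isometry `H′_v ≅ Φ₃`) to FLICKER's literal `t_π(x₁,x₂,x₃)` through the frame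
`Q = Tl⁻¹·(D_π h)` with Gram `diag(−2π, 1, 2π)` — the `e = ½` frame.  Here the literal is the TRACE literal of ★ p851724∕p851796,
`t_π^{(b)}(x₁,x₂,x₃) = !![x₁σb + x₃b, 0, π(x₁ − x₃); 0, x₂, 0; π′bσb(x₁ − x₃), 0, x₁b + x₃σb]` (`b + σb = 1`, `ππ′ = 1`), and the frame is
`F = Tl⁻¹·diag(π,1,1)·Q_b`, `Q_b = !![1,0,1; 0,1,0; b,0,−σb]`, with Gram

  `ᵗσ(diag(π,1,1)·Q_b)·Φ₃·(diag(π,1,1)·Q_b) = diag(π, 1, −π)`   (`gram_traceFrame_pi`; at `π = 1` this is ★ (T1) `twistGram_traceFrame`'s `diag(1,1,−1)`).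

FINDING #15 (census §0.3): the ORDERS of the lengths `(π, 1, −π)` are those of Flicker's `(−2π, 1, 2π)` whenever `|2| = 1`, and at a dyadic place the trace frame is the
self-dual-adapted one (CENSUS-R1 R-b) — so ROW 2's parity criterion (`ord π_w + Q₁ + P`, `Q₁ + Q₂`, `ord π_w + P + Q₂` even) and its printed value
`[(Q₁+P) % 2 = 1 ∧ (Q₁+Q₂) % 2 = 0]·(q+1)²q^{Q₁+Q₂+P−2}` carry over VERBATIM to the dyadic place with NO `ord 2` shift (with Flicker's frame they would shift).

* §1 `gram_traceFrame_pi` (ring identity).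
* §2 `exists_traceFramePi_of_congr`, `formCongr_traceFramePi_eq` (θ̄ = 1) and `exists_traceFrameOne_of_congr`, `formCongr_traceFrameOne_eq` (θ̄ = 0; Gram = ★ (T1) CITED) — the
  twins of ★ `exists_framePi_of_congr`, `formCongr_framePi_eq`, `exists_frameOne_of_congr`, `formCongr_frameOne_eq` with `h2e` DELETED and `hb` ADDED; everything else in ★
  `…RowTwoFrame` (§1 valuation bridges, §2 `odd_log_valued_of_forall_conjLocal_mul_ne`, §4 `formCongr_map_evalRingHom`, `one_le_of_valued_sub_eq_exp`) is 2-free and CITED by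
  (C6)-2∕-3.
HONEST LABEL: HC_CM is proved only modulo the printed citations (hLiu418 = `stmt-HodgeConjecture-24832`, h413 = `stmt-HodgeConjecture-24833`) until rung 0 closes; (D-UNR) stays
PRINT by D74′; this is frame bookkeeping, it pays no organ and opens no road.

## References
* [Flicker1998UnitaryFL] Y. Z. Flicker, *Elementary proof of the fundamental lemma for a unitary group*, Canad. J. Math. 50 (1998), §2 Prop. 3 pp. 78–79 (the literals and
  their eigenframes).
* [Jacobowitz1962] R. Jacobowitz, *Hermitian forms over local fields*, Amer. J. Math. 84 (1962), §4 (4.2)–(4.4), §7 Thm. 7.1 (unimodular lattices, unramified case).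
* [Rogawski1990] J. D. Rogawski, *Automorphic Representations of Unitary Groups in Three Variables* (1990), §4.9 pp. 54–56.
-/

set_option autoImplicit false

noncomputable section

open NumberField IsDedekindDomain Matrix Polynomial
open Literature.NumberTheory.Automorphic Literature.NumberTheory.Automorphic.UnitaryGroup
open scoped Matrix MatrixGroups ValuativeRel

namespace Literature.NumberTheory.Rogawski1990

/-! ## §1 The Gram matrix of the π-twisted trace frame (ring identity) -/

section Ring

variable {R : Type*} [CommRing R] (σ : R →+* R)

/-- **`ᵗσ(diag(π,1,1)·Q_b)·Φ₃·(diag(π,1,1)·Q_b) = diag(π, 1, −π)`** for `Q_b = !![1,0,1; 0,1,0; b,0,−σb]`, `σσ = id`, `b + σb = 1`, `σπ = π`: the columns `(π,0,b)`, `e₂`,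
`(π,0,−σb)` are `Φ₃`-orthogonal of lengths `π(b + σb) = π`, `1`, `−π(σb + b) = −π` (★ (T1) `twistGram_traceFrame` is `π = 1`; contrast ★ `gram_flickerFrame_pi`:
`diag(−2π, 1, 2π)`). [cite: Flicker1998UnitaryFL, §2 Prop. 3 pp. 78–79] [cite: Jacobowitz1962, §4 (4.2)–(4.4)] -/
theorem gram_traceFrame_pi (hσσ : ∀ x, σ (σ x) = x) {b : R} (hb : b + σ b = 1) {π : R} (hσπ : σ π = π) :
    ((!![π, 0, 0; 0, 1, 0; 0, 0, 1] * !![(1 : R), 0, 1; 0, 1, 0; b, 0, -σ b]).map σ)ᵀ * (Matrix.of fun i j : Fin 3 => if i.val + j.val + 1 = 3 then (1 : R) else 0) *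
        (!![π, 0, 0; 0, 1, 0; 0, 0, 1] * !![(1 : R), 0, 1; 0, 1, 0; b, 0, -σ b]) =
      !![π, 0, 0; 0, 1, 0; 0, 0, -π] := by
  have hb' : σ b + b = 1 := by rw [add_comm]; exact hb
  ext i j
  fin_cases i <;> fin_cases j <;>
    simp [Matrix.mul_apply, Fin.sum_univ_three, Matrix.of_apply, map_neg, hσσ, hσπ] <;> grind

end Ring

/-! ## §2 The explicit eigenframes of a congruent element and their Gram matrices -/

section Frames

variable (L : Type) [Field L] [NumberField L] [IsCMField L] {v : HeightOneSpectrum (𝓞 ↥(maximalRealSubfield L))}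

/-- **THE EXPLICIT EIGENFRAME `F = Tl⁻¹·diag(π,1,1)·Q_b`** of `t` congruent to the trace literal `t_π^{(b)}(x₁,x₂,x₃)`: `t · F = F · diag(x₁,x₂,x₃)` — ★ p851796
`exists_frame_of_congr_traceTorusEltPi` with the frame KEPT EXPLICIT for its Gram matrix (twin of ★ `exists_framePi_of_congr`, NO `2e = 1`).
[cite: Flicker1998UnitaryFL, §2 Prop. 3 pp. 78–79] -/
theorem exists_traceFramePi_of_congr (H' : Matrix (Fin 3) (Fin 3) L) {b π π' x₁ x₂ x₃ : LocalRing L v}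
    (hb : b + conjLocal L (IsCMField.complexConj L) v b = 1) (hππ : π * π' = 1)
    (Tl : GL (Fin 3) (LocalRing L v))
    (ψ : ↥(UnitaryGroup.«local» L (IsCMField.complexConj L) 3 H' v) ≃ₜ*
        ↥(UnitaryGroup.«local» L (IsCMField.complexConj L) 3 (Matrix.of fun i j : Fin 3 => if i.val + j.val + 1 = 3 then (1 : L) else 0) v))
    (t : (cmDatum L 3 H').Local v) (hψ : ∀ g, (ψ g).val = Tl * g.val * Tl⁻¹)
    (hlit : (ψ t).val.val = !![x₁ * conjLocal L (IsCMField.complexConj L) v b + x₃ * b, 0, π * (x₁ - x₃); 0, x₂, 0;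
      π' * (b * conjLocal L (IsCMField.complexConj L) v b * (x₁ - x₃)), 0, x₁ * b + x₃ * conjLocal L (IsCMField.complexConj L) v b]) :
    ∃ P₁ : GL (Fin 3) (LocalRing L v), P₁.val = !![π, 0, 0; 0, 1, 0; 0, 0, 1] *
        !![(1 : LocalRing L v), 0, 1; 0, 1, 0; b, 0, -conjLocal L (IsCMField.complexConj L) v b] ∧
      (t.val.val : Matrix (Fin 3) (Fin 3) (LocalRing L v)) * (Tl⁻¹ * P₁).val = (Tl⁻¹ * P₁).val * diagonal ![x₁, x₂, x₃] := by
  obtain ⟨Qb, hQb, -⟩ := exists_generalLinearGroup_traceFrame (conjLocal L (IsCMField.complexConj L) v) hb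
  obtain ⟨D, hD, -⟩ := exists_generalLinearGroup_diagPi (R := LocalRing L v) hππ
  obtain ⟨F, hF⟩ : ∃ F : GL (Fin 3) (LocalRing L v), F.val = !![π, 0, 0; 0, 1, 0; 0, 0, 1] *
      !![(1 : LocalRing L v), 0, 1; 0, 1, 0; b, 0, -conjLocal L (IsCMField.complexConj L) v b] :=
    ⟨D * Qb, by rw [Units.val_mul, hD, hQb]⟩
  have htval : (t.val.val : Matrix (Fin 3) (Fin 3) (LocalRing L v)) = Tl⁻¹.val * (ψ t).val.val * Tl.val := by
    rw [hψ t, Units.val_mul, Units.val_mul, ← Matrix.mul_assoc, ← Matrix.mul_assoc, ← Units.val_mul, inv_mul_cancel, Units.val_one, Matrix.one_mul,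
      Matrix.mul_assoc, ← Units.val_mul, inv_mul_cancel, Units.val_one, Matrix.mul_one]
  have hframe : (ψ t).val.val * F.val = F.val * diagonal ![x₁, x₂, x₃] := by
    rw [hlit, hF, Flicker1998.diagonal_fin_three, ← Matrix.mul_assoc,
      ← diag_mul_traceTorusElt (conjLocal L (IsCMField.complexConj L) v) hππ b x₁ x₂ x₃, Matrix.mul_assoc,
      traceTorusElt_mul_frame (conjLocal L (IsCMField.complexConj L) v) hb x₁ x₂ x₃, Matrix.mul_assoc]
  have hlit' : (ψ t).val.val = F.val * diagonal ![x₁, x₂, x₃] * (F⁻¹).val := by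
    rw [← hframe, Matrix.mul_assoc, ← Units.val_mul, mul_inv_cancel, Units.val_one, Matrix.mul_one]
  refine ⟨F, hF, ?_⟩
  rw [htval, Units.val_mul, hlit', Matrix.mul_assoc, Matrix.mul_assoc, Matrix.mul_assoc, ← Matrix.mul_assoc Tl.val, ← Units.val_mul, mul_inv_cancel,
    Units.val_one, Matrix.one_mul, ← Units.val_mul F⁻¹, inv_mul_cancel, Units.val_one, Matrix.mul_one, ← Matrix.mul_assoc]

omit [IsCMField L] in
/-- **THE GRAM MATRIX OF THE TRACE FRAME**: for the ISOMETRY `Tl` (`formCongr σ Tl Φ₃ = H′_v`) the frame `F = Tl⁻¹·diag(π,1,1)·Q_b` has `formCongr σ F H′_v = diag(π, 1, −π)`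
(§1 `gram_traceFrame_pi`) — the `hG`∕`hd` binder of ★ `exists_moebius_literal_of_congr_conj_diagonal` and of the ROW-2 counts (twin of ★ `formCongr_framePi_eq`'s
`diag(−2π, 1, 2π)`; FINDING #15). [cite: Flicker1998UnitaryFL, §2 Prop. 3 pp. 78–79] [cite: Jacobowitz1962, §7 Thm. 7.1] -/
theorem formCongr_traceFramePi_eq (σ : LocalRing L v →+* LocalRing L v) (hσσ : ∀ x, σ (σ x) = x) {b : LocalRing L v} (hb : b + σ b = 1)
    {π : LocalRing L v} (hσπ : σ π = π) (Hv : Matrix (Fin 3) (Fin 3) (LocalRing L v)) (Tl P₁ : GL (Fin 3) (LocalRing L v))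
    (hTl : formCongr σ Tl (Matrix.of fun i j : Fin 3 => if i.val + j.val + 1 = 3 then (1 : LocalRing L v) else 0) = Hv)
    (hP₁ : P₁.val = !![π, 0, 0; 0, 1, 0; 0, 0, 1] * !![(1 : LocalRing L v), 0, 1; 0, 1, 0; b, 0, -σ b]) :
    formCongr σ (Tl⁻¹ * P₁) Hv = !![π, 0, 0; 0, 1, 0; 0, 0, -π] := by
  rw [← hTl, formCongr_mul σ _ Tl⁻¹ P₁,
    ← formCongr_mul σ (Matrix.of fun i j : Fin 3 => if i.val + j.val + 1 = 3 then (1 : LocalRing L v) else 0) Tl Tl⁻¹, mul_inv_cancel,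
    UnitaryGroup.formCongr_one_eq]
  change ((P₁ : Matrix (Fin 3) (Fin 3) (LocalRing L v)).map σ)ᵀ * _ * (P₁ : Matrix (Fin 3) (Fin 3) (LocalRing L v)) = _
  rw [show (P₁ : Matrix (Fin 3) (Fin 3) (LocalRing L v)) = P₁.val from rfl, hP₁]
  exact gram_traceFrame_pi σ hσσ hb hσπ

/-- **THE EXPLICIT EIGENFRAME `F = Tl⁻¹·Q_b`** of `t` congruent to the θ̄ = 0 trace literal `t_1^{(b)}(x₁,x₂,x₃)` (★ p851796 `exists_frame_of_congr_traceTorusElt`, frame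
kept explicit; twin of ★ `exists_frameOne_of_congr`, NO `2e = 1`). [cite: Flicker1998UnitaryFL, §2 Prop. 3 pp. 78–79] -/
theorem exists_traceFrameOne_of_congr (H' : Matrix (Fin 3) (Fin 3) L) {b x₁ x₂ x₃ : LocalRing L v}
    (hb : b + conjLocal L (IsCMField.complexConj L) v b = 1)
    (Tl : GL (Fin 3) (LocalRing L v))
    (ψ : ↥(UnitaryGroup.«local» L (IsCMField.complexConj L) 3 H' v) ≃ₜ*
        ↥(UnitaryGroup.«local» L (IsCMField.complexConj L) 3 (Matrix.of fun i j : Fin 3 => if i.val + j.val + 1 = 3 then (1 : L) else 0) v))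
    (t : (cmDatum L 3 H').Local v) (hψ : ∀ g, (ψ g).val = Tl * g.val * Tl⁻¹)
    (hlit : (ψ t).val.val = !![x₁ * conjLocal L (IsCMField.complexConj L) v b + x₃ * b, 0, x₁ - x₃; 0, x₂, 0;
      b * conjLocal L (IsCMField.complexConj L) v b * (x₁ - x₃), 0, x₁ * b + x₃ * conjLocal L (IsCMField.complexConj L) v b]) :
    ∃ P₁ : GL (Fin 3) (LocalRing L v), P₁.val = !![(1 : LocalRing L v), 0, 1; 0, 1, 0; b, 0, -conjLocal L (IsCMField.complexConj L) v b] ∧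
      (t.val.val : Matrix (Fin 3) (Fin 3) (LocalRing L v)) * (Tl⁻¹ * P₁).val = (Tl⁻¹ * P₁).val * diagonal ![x₁, x₂, x₃] := by
  obtain ⟨F, hF, -⟩ := exists_generalLinearGroup_traceFrame (conjLocal L (IsCMField.complexConj L) v) hb
  have htval : (t.val.val : Matrix (Fin 3) (Fin 3) (LocalRing L v)) = Tl⁻¹.val * (ψ t).val.val * Tl.val := by
    rw [hψ t, Units.val_mul, Units.val_mul, ← Matrix.mul_assoc, ← Matrix.mul_assoc, ← Units.val_mul, inv_mul_cancel, Units.val_one, Matrix.one_mul,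
      Matrix.mul_assoc, ← Units.val_mul, inv_mul_cancel, Units.val_one, Matrix.mul_one]
  have hF' : F.val = !![(1 : LocalRing L v), 0, 1; 0, 1, 0; b, 0, -conjLocal L (IsCMField.complexConj L) v b] := hF
  have hframe : (ψ t).val.val * F.val = F.val * diagonal ![x₁, x₂, x₃] := by
    rw [hlit, hF', Flicker1998.diagonal_fin_three, traceTorusElt_mul_frame (conjLocal L (IsCMField.complexConj L) v) hb x₁ x₂ x₃]
  have hlit' : (ψ t).val.val = F.val * diagonal ![x₁, x₂, x₃] * (F⁻¹).val := by
    rw [← hframe, Matrix.mul_assoc, ← Units.val_mul, mul_inv_cancel, Units.val_one, Matrix.mul_one]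
  refine ⟨F, hF', ?_⟩
  rw [htval, Units.val_mul, hlit', Matrix.mul_assoc, Matrix.mul_assoc, Matrix.mul_assoc, ← Matrix.mul_assoc Tl.val, ← Units.val_mul, mul_inv_cancel,
    Units.val_one, Matrix.one_mul, ← Units.val_mul F⁻¹, inv_mul_cancel, Units.val_one, Matrix.mul_one, ← Matrix.mul_assoc]

omit [IsCMField L] in
/-- **THE GRAM MATRIX OF THE θ̄ = 0 TRACE FRAME `Tl⁻¹·Q_b`** for the isometry `Tl`: `diag(1, 1, −1)` — ★ (T1) `twistGram_traceFrame` CITED (twin of ★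
`formCongr_frameOne_eq`'s `diag(−2, 1, 2)`). [cite: Jacobowitz1962, §4 (4.2)–(4.4)] [cite: Flicker1998UnitaryFL, §2 Prop. 3 p. 79] -/
theorem formCongr_traceFrameOne_eq (σ : LocalRing L v →+* LocalRing L v) (hσσ : ∀ x, σ (σ x) = x) {b : LocalRing L v} (hb : b + σ b = 1)
    (Hv : Matrix (Fin 3) (Fin 3) (LocalRing L v)) (Tl P₁ : GL (Fin 3) (LocalRing L v))
    (hTl : formCongr σ Tl (Matrix.of fun i j : Fin 3 => if i.val + j.val + 1 = 3 then (1 : LocalRing L v) else 0) = Hv)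
    (hP₁ : P₁.val = !![(1 : LocalRing L v), 0, 1; 0, 1, 0; b, 0, -σ b]) :
    formCongr σ (Tl⁻¹ * P₁) Hv = !![1, 0, 0; 0, 1, 0; 0, 0, -1] := by
  rw [← hTl, formCongr_mul σ _ Tl⁻¹ P₁,
    ← formCongr_mul σ (Matrix.of fun i j : Fin 3 => if i.val + j.val + 1 = 3 then (1 : LocalRing L v) else 0) Tl Tl⁻¹, mul_inv_cancel,
    UnitaryGroup.formCongr_one_eq]
  change ((P₁ : Matrix (Fin 3) (Fin 3) (LocalRing L v)).map σ)ᵀ * _ * (P₁ : Matrix (Fin 3) (Fin 3) (LocalRing L v)) = _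
  rw [show (P₁ : Matrix (Fin 3) (Fin 3) (LocalRing L v)) = P₁.val from rfl, hP₁]
  have h := twistGram_traceFrame σ hσσ hb
  rwa [twistGram_def] at h

omit [IsCMField L] in
/-- The Gram of the trace frame read as the `diagonal` of a length vector (the shape the ROW-2 counts and ★ Möbius literal consume: `d = ![π, 1, −π]`).
[cite: Flicker1998UnitaryFL, §2 Prop. 3 pp. 78–79] -/
theorem formCongr_traceFramePi_eq_diagonal (σ : LocalRing L v →+* LocalRing L v) (hσσ : ∀ x, σ (σ x) = x) {b : LocalRing L v} (hb : b + σ b = 1)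
    {π : LocalRing L v} (hσπ : σ π = π) (Hv : Matrix (Fin 3) (Fin 3) (LocalRing L v)) (Tl P₁ : GL (Fin 3) (LocalRing L v))
    (hTl : formCongr σ Tl (Matrix.of fun i j : Fin 3 => if i.val + j.val + 1 = 3 then (1 : LocalRing L v) else 0) = Hv)
    (hP₁ : P₁.val = !![π, 0, 0; 0, 1, 0; 0, 0, 1] * !![(1 : LocalRing L v), 0, 1; 0, 1, 0; b, 0, -σ b]) :
    formCongr σ (Tl⁻¹ * P₁) Hv = diagonal ![π, 1, -π] := by
  rw [formCongr_traceFramePi_eq L σ hσσ hb hσπ Hv Tl P₁ hTl hP₁, Flicker1998.diagonal_fin_three]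

end Frames

end Literature.NumberTheory.Rogawski1990
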